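import Summits.QuantumFields.YangMills.Theorems.ColdStartUniversalityLatticeLangevinWilsonGeneratorPoincare
import HarnessLib

/-!
# Route `ColdStartUniversality` (fixed-cut-off package): Chapman–Kolmogorov on observables and the DYNKIN LIPSCHITZ BOUND
# `|κ_{t+h}F − κ_tF| ≤ h·sup|𝓛F|` for `C³` cylinders

Helper file (seat `ym-line-csu-p1`, g21; `--supports stmt-QuantumFields-27363`).  SU(2) SZZ dynamics at `(L, β')`, ANY realising
kernel family `κ`:
* `transition_transition_cylinder_eq` — `κ_h(κ_t G) = κ_{t+h} G` pointwise for continuous `G` (`chapmanKolmogorov_szz`);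
* `exists_abs_transition_cylinder_sub_le` — for a `C³` compactly supported cylinder `F = f∘coords` there is `C` (`= sup|𝓛F|`) with
  `|κ_{t+h}F(x) − κ_tF(x)| ≤ C·h` for all `t, h, x` (`transitionKernel_dynkin`: `κ_{t+h}F − κ_tF = ∫_t^{t+h} κ_r𝓛F dr`).
Bookkeeping for the entropy-decay argument of `…WilsonEntropyDecay`.  THEOREMS ONLY, no definition, no sorry.  RECORD-rung R3
plumbing at fixed cut-off; nothing here bears on the Yang–Mills mass gap.
-/

set_option autoImplicit false

noncomputable section

namespace Summit.QuantumFields.YangMills.Theorems.ColdStartUniversality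

open MeasureTheory ProbabilityTheory Filter Set Topology
open scoped BigOperators NNReal ENNReal
open Literature.Probability.Process Literature.MathematicalPhysics.QuantumFieldTheory
open Literature.MathematicalPhysics.QuantumLattice (fundamentalRep fundamentalLatticeRep continuous_fundamentalRep)

variable {L : ℕ} [NeZero L]

/-! ## §1. Semigroup bookkeeping: Chapman–Kolmogorov on observables and the Dynkin Lipschitz bound -/

/-- **`κ_h(κ_t G) = κ_{t+h} G`** pointwise, for continuous `G` and any realising kernel family (Chapman–Kolmogorov
`κ_{h+t} = κ_t ∘ₖ κ_h`). [cite: ShenZhuZhu2022, §3 (Markov semigroup P_t^L after Lemma 3.3, p. 13)] -/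
theorem transition_transition_cylinder_eq (L : ℕ) [NeZero L] (β' : ℝ)
    (κ : ℝ≥0 → Kernel (GaugeConfig 3 L (Matrix.specialUnitaryGroup (Fin 2) ℂ))
      (GaugeConfig 3 L (Matrix.specialUnitaryGroup (Fin 2) ℂ))) [∀ t, IsMarkovKernel (κ t)]
    (hreal : ∀ (t : ℝ≥0) (x : GaugeConfig 3 L (Matrix.specialUnitaryGroup (Fin 2) ℂ))
        (Ω : Type) [MeasurableSpace Ω] (P : Measure Ω) [IsProbabilityMeasure P]
        (W : ℝ≥0 → Ω → (Edge 3 L × NoiseIdx 2 → ℝ)) (hW : IsFlatBrownian W P)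
        (U : ℝ≥0 → Ω → GaugeConfig 3 L (Matrix.specialUnitaryGroup (Fin 2) ℂ)),
        (∀ ω, U 0 ω = x) →
        (latticeLangevinDynamics (fundamentalLatticeRep 2) β').IsSolution (fundamentalRep (Fin 2))
          hW.natFiltration P W U →
        κ t x = P.map (U t))
    {G : GaugeConfig 3 L (Matrix.specialUnitaryGroup (Fin 2) ℂ) → ℝ} (hG : Continuous G) (t h : ℝ≥0)
    (x : GaugeConfig 3 L (Matrix.specialUnitaryGroup (Fin 2) ℂ)) :
    ∫ y, (∫ z, G z ∂(κ t y)) ∂(κ h x) = ∫ z, G z ∂(κ (t + h) x) := by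
  classical
  haveI := secondCountableTopology_su2
  haveI := borelSpace_config L
  obtain ⟨M, -, hM⟩ := exists_abs_le_of_continuous hG
  have hCK : κ (h + t) = κ t ∘ₖ κ h := chapmanKolmogorov_szz β' κ hreal h t
  rw [add_comm t h, hCK, Kernel.comp_apply]
  have hint : Integrable G ((κ h x).bind (κ t)) := by
    haveI : IsProbabilityMeasure ((κ h x).bind (κ t)) := by
      constructor
      rw [Measure.bind_apply MeasurableSet.univ (κ t).measurable.aemeasurable]
      simp
    exact (integrable_const M).mono' hG.measurable.aestronglyMeasurable
      (Eventually.of_forall fun z => by simpa [Real.norm_eq_abs] using hM z)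
  exact (Harris.integral_comp_measure (κ t) (κ h x) hint).symm

/-- **Dynkin Lipschitz bound**: for a `C³` compactly supported cylinder `F = f∘coords` there is `C` with
`|κ_{t+h}F(x) − κ_tF(x)| ≤ C·h` for all `t, h ≥ 0`, `x` (`κ_{t+h}F − κ_tF = ∫_t^{t+h} κ_r 𝓛F dr`, `C = sup|𝓛F|`). [folklore] -/
theorem exists_abs_transition_cylinder_sub_le (L : ℕ) [NeZero L] (β' : ℝ)
    (κ : ℝ≥0 → Kernel (GaugeConfig 3 L (Matrix.specialUnitaryGroup (Fin 2) ℂ))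
      (GaugeConfig 3 L (Matrix.specialUnitaryGroup (Fin 2) ℂ))) [∀ t, IsMarkovKernel (κ t)]
    (hreal : ∀ (t : ℝ≥0) (x : GaugeConfig 3 L (Matrix.specialUnitaryGroup (Fin 2) ℂ))
        (Ω : Type) [MeasurableSpace Ω] (P : Measure Ω) [IsProbabilityMeasure P]
        (W : ℝ≥0 → Ω → (Edge 3 L × NoiseIdx 2 → ℝ)) (hW : IsFlatBrownian W P)
        (U : ℝ≥0 → Ω → GaugeConfig 3 L (Matrix.specialUnitaryGroup (Fin 2) ℂ)),
        (∀ ω, U 0 ω = x) →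
        (latticeLangevinDynamics (fundamentalLatticeRep 2) β').IsSolution (fundamentalRep (Fin 2))
          hW.natFiltration P W U →
        κ t x = P.map (U t))
    {f : (Edge 3 L × Fin 2 × Fin 2 × Bool → ℝ) → ℝ} (hf : ContDiff ℝ 3 f) (hfc : HasCompactSupport f) :
    ∃ C : ℝ, 0 ≤ C ∧ ∀ (t h : ℝ≥0) (x : GaugeConfig 3 L (Matrix.specialUnitaryGroup (Fin 2) ℂ)),
      |(∫ y, f (fun q => (fun z : ℂ => if q.2.2.2 then z.im else z.re)
            ((fundamentalRep (Fin 2) (y q.1) : Matrix (Fin 2) (Fin 2) ℂ) q.2.1 q.2.2.1)) ∂(κ (t + h) x)) -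
        ∫ y, f (fun q => (fun z : ℂ => if q.2.2.2 then z.im else z.re)
            ((fundamentalRep (Fin 2) (y q.1) : Matrix (Fin 2) (Fin 2) ℂ) q.2.1 q.2.2.1)) ∂(κ t x)| ≤ C * h := by
  classical
  haveI := secondCountableTopology_su2
  haveI := borelSpace_config L
  let coords : GaugeConfig 3 L (Matrix.specialUnitaryGroup (Fin 2) ℂ) → (Edge 3 L × Fin 2 × Fin 2 × Bool → ℝ) :=
    fun V q => (fun z : ℂ => if q.2.2.2 then z.im else z.re)
      ((fundamentalRep (Fin 2) (V q.1) : Matrix (Fin 2) (Fin 2) ℂ) q.2.1 q.2.2.1)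
  let gen : GaugeConfig 3 L (Matrix.specialUnitaryGroup (Fin 2) ℂ) → ℝ := fun V =>
    (∑ i : Edge 3 L × Fin 2 × Fin 2 × Bool, fderiv ℝ f (coords V) (Pi.single i 1) *
        (fun z : ℂ => if i.2.2.2 then z.im else z.re)
          ((latticeLangevinDynamics (fundamentalLatticeRep 2) β').drift
            (matrixConfig (fundamentalRep (Fin 2)) V) i.1 i.2.1 i.2.2.1) +
    1 / 2 * ∑ i : Edge 3 L × Fin 2 × Fin 2 × Bool, ∑ j : Edge 3 L × Fin 2 × Fin 2 × Bool,
      fderiv ℝ (fun z => fderiv ℝ f z (Pi.single i 1)) (coords V) (Pi.single j 1) *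
        ∑ n : Edge 3 L × NoiseIdx 2,
          (if n.1 = i.1 then (fun z : ℂ => if i.2.2.2 then z.im else z.re)
            ((latticeLangevinDynamics (fundamentalLatticeRep 2) β').noise
              (matrixConfig (fundamentalRep (Fin 2)) V) i.1 n.2 i.2.1 i.2.2.1) else 0) *
          (if n.1 = j.1 then (fun z : ℂ => if j.2.2.2 then z.im else z.re)
            ((latticeLangevinDynamics (fundamentalLatticeRep 2) β').noise
              (matrixConfig (fundamentalRep (Fin 2)) V) j.1 n.2 j.2.1 j.2.2.1) else 0))
  have hgenc : Continuous gen := continuous_generator (L := L) β' (hf.of_le (by norm_num))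
  obtain ⟨Mg, hMg0, hMg⟩ := exists_abs_le_of_continuous hgenc
  refine ⟨Mg, hMg0, fun t h x => ?_⟩
  set g : ℝ → ℝ := fun r => ∫ y, gen y ∂(κ r.toNNReal x) with hg
  have hD1 := transitionKernel_dynkin (L := L) β' κ hreal hf hfc x (show (0 : ℝ) ≤ t from t.2)
  have hD2 := transitionKernel_dynkin (L := L) β' κ hreal hf hfc x (show (0 : ℝ) ≤ (t : ℝ) + h by positivity)
  have e1 : ((t : ℝ)).toNNReal = t := Real.toNNReal_coe
  have e2 : ((t : ℝ) + h).toNNReal = t + h := by rw [← NNReal.coe_add, Real.toNNReal_coe]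
  rw [e1] at hD1
  rw [e2] at hD2
  have hgc : Continuous g :=
    (continuous_transitionKernel_action β' κ hreal hgenc).comp (continuous_real_toNNReal.prodMk continuous_const)
  have hgb : ∀ r, |g r| ≤ Mg := fun r =>
    abs_integral_le_of_abs_le_of_isProbabilityMeasure (μ := κ r.toNNReal x) hMg
  have hsub : (∫ r in (0 : ℝ)..((t : ℝ) + h), g r) - ∫ r in (0 : ℝ)..(t : ℝ), g r = ∫ r in (t : ℝ)..((t : ℝ) + h), g r :=
    intervalIntegral.integral_interval_sub_left (hgc.intervalIntegrable _ _) (hgc.intervalIntegrable _ _)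
  have hbd : |∫ r in (t : ℝ)..((t : ℝ) + h), g r| ≤ Mg * |((t : ℝ) + h) - t| := by
    have := intervalIntegral.norm_integral_le_of_norm_le_const (a := (t : ℝ)) (b := (t : ℝ) + h) (f := g) (C := Mg)
      (fun r _ => by rw [Real.norm_eq_abs]; exact hgb r)
    rwa [Real.norm_eq_abs] at this
  have e3 : |((t : ℝ) + h) - t| = h := by rw [add_sub_cancel_left, NNReal.abs_eq]
  rw [e3] at hbd
  change |(∫ y, f (coords y) ∂(κ (t + h) x)) - ∫ y, f (coords y) ∂(κ t x)| ≤ Mg * h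
  rw [hD1, hD2]
  have e4 : f (coords x) + (∫ r in (0 : ℝ)..((t : ℝ) + h), g r) - (f (coords x) + ∫ r in (0 : ℝ)..(t : ℝ), g r) =
      ∫ r in (t : ℝ)..((t : ℝ) + h), g r := by rw [← hsub]; ring
  rw [e4]
  exact hbd

end Summit.QuantumFields.YangMills.Theorems.ColdStartUniversality

end
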